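import Summits.HodgeConjecture.HodgeConjecture.Theses.TropicalKugaSatakeCayley
import Literature.AlgebraicGeometry.AbelianVarieties.PolarisedTorusAlgebraic
import HarnessLib

/-!
# Route `TropicalKugaSatakeCayley`, support item S3 `KSModelExists` (stmt-HodgeConjecture-18572) — PROVED

For every `z ∈ ℂ⁵` with `Im z` in the positive cone `ksPosCone` of the explicit rank-7 Kuga–Satake
linear family (`Literature.AlgebraicGeometry.Tropical.KugaSatakeLinearFamily`), the symmetric complex
matrix `τ(z) = ksPeriod z = Σ zᵢ • ksForm i` has positive definite imaginary part
`Im τ(z) = ksMatrix (Im z)`, so `τ(z)` lies in the Siegel upper half space `𝔥₈`; hence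
(Lefschetz's theorem — the theta functions of level three embed the principally polarised torus
`ℂ⁸/(ℤ⁸ ⊕ τ(z)ℤ⁸)` into projective space — followed by Chow's theorem and Serre's GAGA, all PROVED in
the tree and packaged as `Literature.AlgebraicGeometry.AbelianVarieties.exists_smoothProjective_torus_typeD`
with polarisation type `D = 1`) there are a period isomorphism `Φ : ℝ⁸ ⊕ ℝ⁸ ≃ ℂ⁸`, `(x, y) ↦ x + τ(z)y`
(`IsKSPeriodMap z Φ`), a smooth projective `8`-fold `X/ℂ` and an analytification
`φ : ComplexTorus Φ → X(ℂ)`. This is the route decl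
`Summit.HodgeConjecture.HodgeConjecture.Theses.TropicalKugaSatakeCayley.KSModelExists` verbatim
(`ksModelExists_proof`).

No definitions, no named facts, no sorry.

## References

* [LangeBirkenhake1992] H. Lange, Ch. Birkenhake, Complex Abelian Varieties (1992), Thm. 4.5.1
  (Lefschetz), §8.1 (period matrices), App. A (Chow).
* [MumfordTata1] D. Mumford, Tata Lectures on Theta I (1983), Ch. II §1, Thm. 1.3.
* [SerreGAGA1956] J.-P. Serre, Géométrie algébrique et géométrie analytique (1956), §2 n°5–6, §3.
-/

noncomputable section

set_option linter.dupNamespace false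

namespace Summit.HodgeConjecture.HodgeConjecture.Theorems

open Literature.AlgebraicGeometry.Tropical
open Literature.AlgebraicGeometry.Motives (SchemeOver ComplexPoints IsSmoothProjective)
open Literature.Geometry.Kaehler (ComplexTorus)
open Literature.NumberTheory.Transcendental (IsAnalytification)

/-- The entries of `τ(z) = ksPeriod z`: `τ(z)ᵢⱼ = Σₖ zₖ · (ksForm k)ᵢⱼ`. [folklore] -/
theorem ksPeriod_apply (z : Fin 5 → ℂ) (i j : Fin 8) :
    ksPeriod z i j = ∑ k : Fin 5, z k * ((ksForm k i j : ℤ) : ℂ) := by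
  simp [ksPeriod, Matrix.sum_apply]

/-- The entries of `B_v = ksMatrix v`: `(B_v)ᵢⱼ = Σₖ vₖ · (ksForm k)ᵢⱼ`. [folklore] -/
theorem ksMatrix_apply (v : Fin 5 → ℝ) (i j : Fin 8) :
    ksMatrix v i j = ∑ k : Fin 5, v k * ((ksForm k i j : ℤ) : ℝ) := by
  simp [ksMatrix, Matrix.sum_apply]

/-- Every form of the Kuga–Satake family is symmetric, entrywise. [folklore] -/
theorem ksForm_apply_comm (k : Fin 5) (i j : Fin 8) : ksForm k i j = ksForm k j i := by
  have h := congrFun (congrFun (ksForm_transpose k) j) i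
  rw [Matrix.transpose_apply] at h
  exact h

/-- `τ(z) = ksPeriod z` is a symmetric matrix. [folklore] -/
theorem ksPeriod_symm (z : Fin 5 → ℂ) (i j : Fin 8) : ksPeriod z i j = ksPeriod z j i := by
  rw [ksPeriod_apply, ksPeriod_apply]
  exact Finset.sum_congr rfl fun k _ => by rw [ksForm_apply_comm]

/-- The imaginary part of `τ(z)` is the real form of the family at `Im z`:
`Im (ksPeriod z) = ksMatrix (Im z)` entrywise (the forms `ksForm k` are real). [folklore] -/
theorem im_ksPeriod (z : Fin 5 → ℂ) (i j : Fin 8) :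
    (ksPeriod z i j).im = ksMatrix (fun k => (z k).im) i j := by
  rw [ksPeriod_apply, ksMatrix_apply, Complex.im_sum]
  exact Finset.sum_congr rfl fun k _ => by simp [Complex.mul_im]

/-- For `Im z ∈ ksPosCone` the imaginary part of `τ(z)` is positive definite, i.e. `τ(z) ∈ 𝔥₈`
(the tube domain over the positive cone). [folklore] -/
theorem im_ksPeriod_posDef {z : Fin 5 → ℂ} (hz : (fun i => (z i).im) ∈ ksPosCone) :
    (Matrix.of fun i j => (ksPeriod z i j).im).PosDef := by
  have h : (Matrix.of fun i j => (ksPeriod z i j).im) = ksMatrix (fun k => (z k).im) := by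
    ext i j
    rw [Matrix.of_apply, im_ksPeriod]
  rw [h]
  exact hz

/-- **Support item S3 `KSModelExists` of route `TropicalKugaSatakeCayley` (stmt-HodgeConjecture-18572),
PROVED.** For `Im z ∈ ksPosCone` there are a period isomorphism `Φ : ℝ⁸ ⊕ ℝ⁸ ≃ ℂ⁸`,
`(x, y) ↦ x + τ(z)y` (`IsKSPeriodMap z Φ`), a smooth projective `8`-fold `X/ℂ` and an analytification
`φ : ComplexTorus Φ → X(ℂ)` of it by the principally polarised torus `ℂ⁸/(ℤ⁸ ⊕ τ(z)ℤ⁸)`: `τ(z)` is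
symmetric (`ksPeriod_symm`) with positive definite imaginary part (`im_ksPeriod_posDef`), and the
tree's `AbelianVarieties.exists_smoothProjective_torus_typeD` (Lefschetz's theta embedding of type
`D`, Chow, GAGA) with `D = 1` supplies `Φ`, `X` and `φ`. [cite: LangeBirkenhake1992, Thm. 4.5.1 and §8.1]
[cite: MumfordTata1, Ch. II §1 Thm. 1.3] [cite: SerreGAGA1956, §2 n°5–6 and §3 Prop. 13] -/
theorem ksModelExists_proof :
    Summit.HodgeConjecture.HodgeConjecture.Theses.TropicalKugaSatakeCayley.KSModelExists := by
  intro z hz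
  obtain ⟨Φ, hΦ, N, X, ι, _, _, φ, hφ, hX⟩ :=
    Literature.AlgebraicGeometry.AbelianVarieties.exists_smoothProjective_torus_typeD
      (ksPeriod z) (ksPeriod_symm z) (im_ksPeriod_posDef hz) (fun _ => 1) (fun _ => Nat.one_pos)
  have hKS : IsKSPeriodMap z Φ := by
    intro x
    funext i
    rw [hΦ x i]
    simp only [Nat.cast_one, one_mul]
  exact ⟨Φ, hKS, X, hX, φ, hφ⟩

end Summit.HodgeConjecture.HodgeConjecture.Theorems

end
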